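import Summits.Langlands.Langlands.Theses.BrauerHeilbronnDescent
import Literature.NumberTheory.GaloisRepresentations.IntegralGaloisActionProofs
import HarnessLib

/-!
# `CoherentPotentialAutomorphy` — small-model facts from the birth vetting (refuter)

Structural lemmas about the matching clause
`(ρ.restrictField E).HasFrobCharpolyAt w (arithFrobPolyOfSatake ι q_w 1 (∑ j, α j))`
of the crux `Summit.Langlands.Langlands.Theses.BrauerHeilbronnDescent.CoherentPotentialAutomorphy`
(item stmt-Langlands-19253):

* `natDegree_eq_of_hasFrobCharpolyAt` — a polynomial pinned as the characteristic polynomial of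
  the arithmetic Frobenii at a finite place of a number field has degree `n` (primes above `w`
  and Frobenius elements EXIST: `primesAbove_nonempty`,
  `exists_isArithFrobAt_of_mem_primesAbove_holds`, both proved), so the clause is never vacuous;
* `not_hasFrobCharpolyAt_one` — hence the degenerate witness "empty isobaric family" (`k = 0`,
  predicted polynomial `1`) is excluded for every `n ≥ 1`: the crux is not trivially inhabited;
* `sum_rank_eq_of_matching` — at any place where the clause holds the ranks of the cuspidal
  pieces add up to `n` (`∑ j, m j = n`): the family is a genuine ordered partition of the rank,
  as for an isobaric sum `π₁ ⊞ ⋯ ⊞ π_k` on `GL_n`.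

None of these asserts a Theses statement; they are the prover's briefing (Negative/ lane).
This file does NOT refute the crux.
-/

namespace Summit.Langlands.Langlands.Theorems.CoherentPotentialAutomorphy.Negative

set_option linter.dupNamespace false -- project-wide option; `Summit.Langlands.Langlands` is the mandated namespace

open Literature.NumberTheory.Automorphic Literature.NumberTheory.GaloisRepresentations
  IsDedekindDomain NumberField Polynomial

variable {E : Type} [Field E] [NumberField E] {ℓ : ℕ} [Fact ℓ.Prime] {n : ℕ}

/-- A Frobenius characteristic polynomial at a finite place of a number field has degree equal
to the rank: there is a prime `𝔓 ∣ w` of `ℤ̄_E` and an arithmetic Frobenius at it, and the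
characteristic polynomial of an `n × n` matrix has degree `n`. [folklore] -/
theorem natDegree_eq_of_hasFrobCharpolyAt (ρ : FramedGaloisRep E (PadicAlgCl ℓ) n)
    (w : HeightOneSpectrum (𝓞 E)) {P : (PadicAlgCl ℓ)[X]} (h : ρ.HasFrobCharpolyAt w P) :
    P.natDegree = n := by
  obtain ⟨𝔓, h𝔓⟩ := HeightOneSpectrum.primesAbove_nonempty w
  obtain ⟨σ, hσ⟩ := HeightOneSpectrum.exists_isArithFrobAt_of_mem_primesAbove_holds h𝔓
  rw [← h 𝔓 h𝔓 σ hσ, FramedRep.charpoly, Matrix.charpoly_natDegree_eq_dim, Fintype.card_fin]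

/-- The empty family is excluded: for `n ≥ 1` no framed Galois representation of rank `n` over a
number field has Frobenius characteristic polynomial `1` at any finite place (the `k = 0`
instance of the crux's matching clause, `arithFrobPolyOfSatake ι q 1 0 = 1`). [folklore] -/
theorem not_hasFrobCharpolyAt_one (hn : 0 < n) (ρ : FramedGaloisRep E (PadicAlgCl ℓ) n)
    (w : HeightOneSpectrum (𝓞 E)) : ¬ ρ.HasFrobCharpolyAt w 1 := fun h => by
  have h1 := natDegree_eq_of_hasFrobCharpolyAt ρ w h
  rw [natDegree_one] at h1
  omega

/-- The `k = 0` instance of the crux's predicted polynomial is the constant `1`. [folklore] -/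
theorem arithFrobPolyOfSatake_sum_fin_zero (ι : PadicAlgCl ℓ ≃+* ℂ) (q : ℕ)
    (α : Fin 0 → Multiset ℂ) : arithFrobPolyOfSatake ι q 1 (∑ j, α j) = 1 := by
  simp [arithFrobPolyOfSatake]

/-- Hence the matching clause of the crux fails for the empty family at EVERY place. [folklore] -/
theorem not_matching_emptyFamily (hn : 0 < n) (ι : PadicAlgCl ℓ ≃+* ℂ)
    (ρ : FramedGaloisRep E (PadicAlgCl ℓ) n) (w : HeightOneSpectrum (𝓞 E))
    (α : Fin 0 → Multiset ℂ) :
    ¬ ρ.HasFrobCharpolyAt w (arithFrobPolyOfSatake ι w.residueCard 1 (∑ j, α j)) := by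
  rw [arithFrobPolyOfSatake_sum_fin_zero]
  exact not_hasFrobCharpolyAt_one hn ρ w

/-- Rank bookkeeping: wherever the matching clause of the crux holds, the ranks of the cuspidal
pieces add up to `n` (`card (α j) = m j` by `HasSatakeParamAt.card_eq`, and the predicted
polynomial has degree `card (∑ j, α j)`). [folklore] -/
theorem sum_rank_eq_of_matching {k : ℕ} {m : Fin k → ℕ}
    {hc : ∀ j, isCompact_glFiniteIntegralLevel (m j) E}
    (π : ∀ j, CuspidalAutomorphicRepData (m j) E (hc j)) (ι : PadicAlgCl ℓ ≃+* ℂ)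
    (ρ : FramedGaloisRep E (PadicAlgCl ℓ) n) (w : HeightOneSpectrum (𝓞 E))
    (α : Fin k → Multiset ℂ) (hα : ∀ j, (π j).1.HasSatakeParamAt w (α j))
    (hρ : ρ.HasFrobCharpolyAt w (arithFrobPolyOfSatake ι w.residueCard 1 (∑ j, α j))) :
    ∑ j, m j = n := by
  have h := natDegree_eq_of_hasFrobCharpolyAt ρ w hρ
  rw [natDegree_arithFrobPolyOfSatake, Multiset.card_sum] at h
  rw [← h]
  exact Finset.sum_congr rfl fun j _ => ((hα j).card_eq).symm

end Summit.Langlands.Langlands.Theorems.CoherentPotentialAutomorphy.Negative
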